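import Summits.CriticalPhenomena.SAWScalingLimit.Theorems.SAWDevelopingMapObservableToSLETypeLadderBandDefs
import Summits.CriticalPhenomena.SAWScalingLimit.Theorems.SAWDevelopingMapObservableToSLETypeLadderBandAssembly
import HarnessLib

/-!
# The one-end band iteration (band iteration, piece I7)

Crux `Summit.CriticalPhenomena.SAWScalingLimit.Theses.SAWDevelopingMap.ObservableToSLE`
(item stmt-CriticalPhenomena-10472), line `six-class-type-ladder`, skeleton r16 (band-wise cut of the
abundance residue): the registered stub `stub_oneEndBound`.

From the per-band renewal bound at the root (`BandBoundAt`: constants `c₀ < 1`, `θ > 1`, `R₂`), the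
no-macroscopic-backtracking bound at the root's marked point `zr`, convergence of the rescaled root to
`zr` and of the rescaled target to `zt ≠ zr`, and a base point `z₀ ≠ zr`, we get for every `ε > 0`:
`R₃ := min R₂ (min (|zr zt|/4) (|z₀ zr|/4))`; for `R ≤ R₃`, `m` bands with `max c₀ 0 ^ m ≤ ε/4`
at the scales of `exists_bandScales` (protection radii chosen top-down through the no-backtracking
radii `r(P/2, ε/4m)`: `P_{m-1} = R`, `ρin_k = min (r_k, P_k)/(2θ)`, `P_{k-1} = ρin_k/2`); the common
window threshold `ρw := min_k ρw_k` and complexity `N := Σ_k N_k` of the `m` instances of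
`BandBoundAt`; eventually in the mesh (a finite intersection: the `m` band statements, the `m`
no-backtracking bounds, the positions of the rescaled root and target, one lattice step below every
`ρin_k/2`) the fixed-mesh assembly `stub_bandAssembly` (piece I7b) yields the family and the bound
`m·ε/(4m) + (max c₀ 0)^m ≤ ε`.
-/

noncomputable section

open scoped BigOperators Topology NNReal ENNReal Classical
open Filter Set MeasureTheory Metric
open Literature.Probability.LatticeModels (HexVertex hexGraph hexCenter triZeta Site)
open Literature.Probability.RandomPlanarGeometry
open Literature.Probability.RandomPlanarGeometry.SAW

namespace Summit.CriticalPhenomena.SAWScalingLimit.Theorems.ObservableToSLE.TypeLadder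

open Summit.CriticalPhenomena.SAWScalingLimit.Theorems.ObservableToSLER.BridgeGate
  (hexBall HasCleanWindow carvedLaw rowOf)
open Summit.CriticalPhenomena.SAWScalingLimit.Theorems.ObservableToSLER.NestedGate

/-! ### Finite minima and the scales -/

/-- A positive real below finitely many positive reals. -/
theorem exists_pos_le_forall (f : ℕ → ℝ) (m : ℕ) (hf : ∀ k, 0 < f k) :
    ∃ a : ℝ, 0 < a ∧ ∀ k, k < m → a ≤ f k := by
  induction m with
  | zero => exact ⟨1, one_pos, fun k hk => absurd hk (Nat.not_lt_zero k)⟩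
  | succ m ih =>
    obtain ⟨a, ha, h⟩ := ih
    refine ⟨min a (f m), lt_min ha (hf m), fun k hk => ?_⟩
    rcases Nat.lt_or_ge k m with hk' | hk'
    · exact (min_le_left _ _).trans (h k hk')
    · have hkm : k = m := by omega
      rw [hkm]
      exact min_le_right _ _

/-- **The scales of the band iteration.**  For a band ratio `θ > 1`, a top radius `R > 0` and a
positive radius function `g` (the no-backtracking radius `P ↦ r(P/2, ε')`), there are protection radii
`P k` and inner radii `ρin k` (`k < m`, band `m - 1` on top) with: `0 < P k ≤ R`,
`0 < ρin k ≤ P k / (2θ)`, outer radius `θ·ρin k ≤ min (P k, g (P k)) / 2`; every lower protection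
radius is at most half an upper inner radius (`P j ≤ ρin k / 2` for `j < k`); consecutive bands are
separated (`θ·ρin k ≤ ρin (k + 1)`).  Construction, top-down: `P_{m-1} := R`,
`ρin_k := min (g P_k, P_k) / (2θ)`, `P_{k-1} := ρin_k / 2` (a `Nat.rec` inside the proof). -/
theorem exists_bandScales (θ R : ℝ) (g : ℝ → ℝ) (m : ℕ) (hθ : 1 < θ) (hR : 0 < R)
    (hg : ∀ p, 0 < p → 0 < g p) :
    ∃ P ρin : ℕ → ℝ,
      (∀ k, k < m → 0 < P k ∧ P k ≤ R ∧ 0 < ρin k ∧ ρin k ≤ P k / (2 * θ) ∧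
        θ * ρin k ≤ P k / 2 ∧ θ * ρin k ≤ g (P k) / 2) ∧
      (∀ j k : ℕ, j < k → k < m → P j ≤ ρin k / 2) ∧
      (∀ k, k + 1 < m → θ * ρin k ≤ ρin (k + 1)) := by
  have hθ0 : 0 < θ := one_pos.trans hθ
  -- top-down recursion: `Q i` is the protection radius of band `m - 1 - i`,
  -- `min (g (Q i)) (Q i) / (2θ)` its inner radius, and `Q (i + 1)` half the latter
  obtain ⟨Q, hQ0, hQs⟩ : ∃ Q : ℕ → ℝ, Q 0 = R ∧
      ∀ i, Q (i + 1) = min (g (Q i)) (Q i) / (2 * θ) / 2 :=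
    ⟨fun i => Nat.rec R (fun _ q => min (g q) q / (2 * θ) / 2) i, rfl, fun _ => rfl⟩
  have hpos : ∀ i, 0 < Q i := by
    intro i
    induction i with
    | zero => rw [hQ0]; exact hR
    | succ i ih =>
      rw [hQs]
      have := lt_min (hg _ ih) ih
      positivity
  -- one band: positivity, the room under the protection radius, monotonicity
  have hone : ∀ i, 0 < min (g (Q i)) (Q i) / (2 * θ) ∧
      min (g (Q i)) (Q i) / (2 * θ) ≤ Q i / (2 * θ) ∧
      θ * (min (g (Q i)) (Q i) / (2 * θ)) ≤ Q i / 2 ∧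
      θ * (min (g (Q i)) (Q i) / (2 * θ)) ≤ g (Q i) / 2 ∧ Q (i + 1) ≤ Q i := by
    intro i
    have hQi := hpos i
    have hmin : 0 < min (g (Q i)) (Q i) := lt_min (hg _ hQi) hQi
    have hle1 : min (g (Q i)) (Q i) ≤ Q i := min_le_right _ _
    have hle2 : min (g (Q i)) (Q i) ≤ g (Q i) := min_le_left _ _
    have hθρ : θ * (min (g (Q i)) (Q i) / (2 * θ)) = min (g (Q i)) (Q i) / 2 := by
      field_simp
    refine ⟨by positivity, div_le_div_of_nonneg_right hle1 (by positivity), by rw [hθρ]; linarith,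
      by rw [hθρ]; linarith, ?_⟩
    rw [hQs i, div_div, div_le_iff₀ (by positivity)]
    have : Q i ≤ Q i * (2 * θ * 2) := by nlinarith
    linarith
  have hanti : ∀ i d, Q (i + d) ≤ Q i := by
    intro i d
    induction d with
    | zero => exact le_rfl
    | succ d ih => exact (hone (i + d)).2.2.2.2.trans ih
  refine ⟨fun k => Q (m - 1 - k), fun k => min (g (Q (m - 1 - k))) (Q (m - 1 - k)) / (2 * θ),
    fun k _ => ?_, fun j k hjk hk => ?_, fun k hk => ?_⟩
  · obtain ⟨h1, h2, h3, h4, -⟩ := hone (m - 1 - k)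
    have hR' : Q (m - 1 - k) ≤ R := by
      have := hanti 0 (m - 1 - k)
      rwa [zero_add, hQ0] at this
    exact ⟨hpos _, hR', h1, h2, h3, h4⟩
  · -- `P j = Q (m - 1 - j) ≤ Q (m - 1 - k + 1) = ρin k / 2`
    show Q (m - 1 - j) ≤ min (g (Q (m - 1 - k))) (Q (m - 1 - k)) / (2 * θ) / 2
    rw [← hQs]
    have hidx : m - 1 - j = m - 1 - k + 1 + (k - j - 1) := by omega
    rw [hidx]
    exact hanti _ _
  · -- `θ ρin k ≤ Q (m - 1 - k) / 2 = Q (i + 1) / 2 ≤ ρin (k + 1)` with `i := m - 1 - (k + 1)`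
    show θ * (min (g (Q (m - 1 - k))) (Q (m - 1 - k)) / (2 * θ)) ≤
      min (g (Q (m - 1 - (k + 1)))) (Q (m - 1 - (k + 1))) / (2 * θ)
    have hidx : m - 1 - k = m - 1 - (k + 1) + 1 := by omega
    refine (hone (m - 1 - k)).2.2.1.trans ?_
    rw [hidx, hQs]
    have := (hone (m - 1 - (k + 1))).1
    linarith

/-! ### The registered stub -/

/-- Registered stub `stub_oneEndBound` (crux item stmt-CriticalPhenomena-10472, skeleton r16, band
iteration piece I7): **the one-end multi-band renewal bound.**  From the per-band bound at the root
(`BandBoundAt`), the no-backtracking bound at the root's marked point `zr` in the root-side shape,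
convergence of the rescaled root to `zr` and of the rescaled target to a different point `zt`, and a
base point `z₀ ≠ zr`: for every `ε` there is `R₃` such that for every `R ≤ R₃` some window threshold
works, and for every window radius below it some complexity: eventually in the mesh ONE tame nested
exterior-anchored class-`j` fat solid family with `z₀`-escapes exists, levels within `R/2` of the
rescaled root, whose probability of carrying no good gate is `≤ ε`.  Proof: module docstring
(scales `exists_bandScales`, thresholds and complexities from the `m` instances of `BandBoundAt`, a
finite intersection of eventualities, then `stub_bandAssembly` at the fixed mesh with `max c₀ 0` and
`ε' = ε/(4m)`, and `m·ε' + (max c₀ 0)^m ≤ ε/4 + ε/4 ≤ ε`). -/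
theorem stub_oneEndBound :
    ∀ (D : DobrushinDomain) (root tgt : ℝ → HexVertex) (zr zt w z₀ : ℂ) (j : Fin 6),
      BandBoundAt D root tgt w z₀ j →
      (∀ R' > (0 : ℝ), ∀ ε > (0 : ℝ), ∃ r > (0 : ℝ), ∀ᶠ δ : ℝ in 𝓝[>] 0,
        hexSAWLaw D.carrier δ (root δ) (tgt δ)
            {γ | ∃ (l₁ l₂ : List HexVertex) (u v : HexVertex), γ.walk.support = l₁ ++ u :: l₂ ∧ v ∈ l₂ ∧
              R' ≤ dist ((δ : ℂ) * hexCenter u) zr ∧ dist ((δ : ℂ) * hexCenter v) zr ≤ r} ≤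
          ENNReal.ofReal ε) →
      Tendsto (fun δ : ℝ => (δ : ℂ) * hexCenter (root δ)) (𝓝[>] 0) (𝓝 zr) →
      Tendsto (fun δ : ℝ => (δ : ℂ) * hexCenter (tgt δ)) (𝓝[>] 0) (𝓝 zt) → zr ≠ zt → z₀ ≠ zr →
      ∀ ε > (0 : ℝ), ∃ R₃ > (0 : ℝ), ∀ R ∈ Set.Ioc (0 : ℝ) R₃, ∃ ρw > (0 : ℝ), ∀ ρ ∈ Set.Ioc (0 : ℝ) ρw,
        ∃ N : ℕ, ∀ᶠ δ : ℝ in 𝓝[>] 0, ∃ S : ℕ → Set HexVertex,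
          TameNestedFamily δ R N (root δ) S ∧ (∀ n, ExteriorAnchored D.carrier δ (S n) (root δ)) ∧
          ClassWindows j D.carrier δ ρ S ∧ FatUnderWindowK j D.carrier δ ρ S (root δ) ∧ FatSpine δ ρ S (root δ) ∧
          (∀ (n : ℕ) (p q : HexVertex), HasCleanWindow D.carrier δ ρ (S n) p q →
            ZEscape D.carrier δ ρ (2 * R) z₀ w (S n) q) ∧
          (∀ n, ∀ v ∈ S n, dist ((δ : ℂ) * hexCenter v) ((δ : ℂ) * hexCenter (root δ)) ≤ R / 2) ∧
          hexSAWLaw D.carrier δ (root δ) (tgt δ)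
              {γ | ¬ GoodRenewalAtN D.carrier δ ρ R S (root δ) γ.walk.support} ≤ ENNReal.ofReal ε := by
  intro D root tgt zr zt w z₀ j hBB hNB hroot htgt hzt hz₀ ε hε
  obtain ⟨c₀, hc₀1, θ, hθ, R₂, hR₂, hband⟩ := hBB
  -- WLOG `0 ≤ c₀`: work with `max c₀ 0`; the number of bands `n + 1`
  have hc₁0 : 0 ≤ max c₀ 0 := le_max_right _ _
  have hc₁1 : max c₀ 0 < 1 := max_lt hc₀1 one_pos
  obtain ⟨n, hn⟩ := exists_pow_lt_of_lt_one (by positivity : (0 : ℝ) < ε / 4) hc₁1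
  have hm : 0 < n + 1 := n.succ_pos
  have hcm : max c₀ 0 ^ (n + 1) ≤ ε / 4 := (pow_le_pow_of_le_one hc₁0 hc₁1.le n.le_succ).trans hn.le
  have hε' : 0 < ε / (4 * ((n + 1 : ℕ) : ℝ)) := by positivity
  -- the no-backtracking radius as a total positive function of the far radius `R'`
  have hNB' : ∀ R' : ℝ, ∃ r : ℝ, 0 < r ∧ (0 < R' → ∀ᶠ δ : ℝ in 𝓝[>] 0,
      hexSAWLaw D.carrier δ (root δ) (tgt δ)
          {γ | ∃ (l₁ l₂ : List HexVertex) (u v : HexVertex), γ.walk.support = l₁ ++ u :: l₂ ∧ v ∈ l₂ ∧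
            R' ≤ dist ((δ : ℂ) * hexCenter u) zr ∧ dist ((δ : ℂ) * hexCenter v) zr ≤ r} ≤
        ENNReal.ofReal (ε / (4 * ((n + 1 : ℕ) : ℝ)))) := by
    intro R'
    by_cases hR' : 0 < R'
    · obtain ⟨r, hr, h⟩ := hNB R' hR' _ hε'
      exact ⟨r, hr, fun _ => h⟩
    · exact ⟨1, one_pos, fun h => absurd h hR'⟩
  choose rNB hrNB0 hrNB using hNB'
  -- the threshold `R₃`
  have hdzt : 0 < dist zr zt := dist_pos.2 hzt
  have hdz₀ : 0 < dist z₀ zr := dist_pos.2 hz₀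
  refine ⟨min R₂ (min (dist zr zt / 4) (dist z₀ zr / 4)),
    lt_min hR₂ (lt_min (by positivity) (by positivity)), ?_⟩
  rintro R ⟨hR0, hR3⟩
  have hRR₂ : R ≤ R₂ := hR3.trans (min_le_left _ _)
  have hRzt : 4 * R ≤ dist zr zt := by
    have := hR3.trans ((min_le_right _ _).trans (min_le_left _ _))
    linarith
  have hRz₀ : 4 * R ≤ dist z₀ zr := by
    have := hR3.trans ((min_le_right _ _).trans (min_le_right _ _))
    linarith
  -- the scales
  obtain ⟨P, ρin, hsc, hdec, hsep⟩ := exists_bandScales θ R (fun p => rNB (p / 2)) (n + 1) hθ hR0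
    fun p _ => hrNB0 _
  -- the window thresholds of the bands
  have hwin : ∀ k, ∃ ρw : ℝ, 0 < ρw ∧ (k < n + 1 → ∀ ρ ∈ Set.Ioc (0 : ℝ) ρw, ∃ N : ℕ,
      ∀ᶠ δ : ℝ in 𝓝[>] 0, ∃ S : ℕ → Set HexVertex,
        BandFamily D.carrier δ (ρin k) (θ * ρin k) ρ (2 * R) z₀ w N j (root δ) S ∧
          ∀ (t : HexVertex) (ω₀ : (hexDomainGraph D.carrier δ).Walk (root δ) t), ω₀.IsPath →
            (∀ v ∈ ω₀.support,
              dist ((δ : ℂ) * hexCenter v) ((δ : ℂ) * hexCenter (root δ)) ≤ ρin k) →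
            carvedLaw D.carrier δ {v | v ∈ ω₀.support ∧ v ≠ t} t (tgt δ)
                {η | ¬ BandSuccess D.carrier δ ρ (P k) S (root δ)
                  (ω₀.support ++ η.walk.support.tail)} ≤
              ENNReal.ofReal c₀) := by
    intro k
    by_cases hk : k < n + 1
    · obtain ⟨hPk, hPkR, hρk, hρkP, -, -⟩ := hsc k hk
      obtain ⟨ρw, hρw, h⟩ := hband R ⟨hR0, hRR₂⟩ (P k) ⟨hPk, hPkR⟩ (ρin k) ⟨hρk, hρkP⟩
      exact ⟨ρw, hρw, fun _ => h⟩
    · exact ⟨1, one_pos, fun h => absurd h hk⟩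
  choose ρwf hρwf0 hρwf using hwin
  obtain ⟨ρw, hρw, hρwle⟩ := exists_pos_le_forall ρwf (n + 1) hρwf0
  refine ⟨ρw, hρw, ?_⟩
  rintro ρ ⟨hρ0, hρle⟩
  -- the complexities of the bands
  have hcx : ∀ k, ∃ N : ℕ, k < n + 1 → ∀ᶠ δ : ℝ in 𝓝[>] 0, ∃ S : ℕ → Set HexVertex,
      BandFamily D.carrier δ (ρin k) (θ * ρin k) ρ (2 * R) z₀ w N j (root δ) S ∧
        ∀ (t : HexVertex) (ω₀ : (hexDomainGraph D.carrier δ).Walk (root δ) t), ω₀.IsPath →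
          (∀ v ∈ ω₀.support,
            dist ((δ : ℂ) * hexCenter v) ((δ : ℂ) * hexCenter (root δ)) ≤ ρin k) →
          carvedLaw D.carrier δ {v | v ∈ ω₀.support ∧ v ≠ t} t (tgt δ)
              {η | ¬ BandSuccess D.carrier δ ρ (P k) S (root δ)
                (ω₀.support ++ η.walk.support.tail)} ≤
            ENNReal.ofReal c₀ := by
    intro k
    by_cases hk : k < n + 1
    · obtain ⟨N, h⟩ := hρwf k hk ρ ⟨hρ0, hρle.trans (hρwle k hk)⟩
      exact ⟨N, fun _ => h⟩
    · exact ⟨0, fun h => absurd h hk⟩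
  choose Nf hNf using hcx
  refine ⟨∑ k ∈ Finset.range (n + 1), Nf k, ?_⟩
  -- EVENTUALLY in the mesh (a finite intersection over the bands, and three more conditions)
  have hall : ∀ᶠ δ : ℝ in 𝓝[>] 0, ∀ k ∈ Finset.range (n + 1),
      (∃ S : ℕ → Set HexVertex,
        BandFamily D.carrier δ (ρin k) (θ * ρin k) ρ (2 * R) z₀ w (Nf k) j (root δ) S ∧
          ∀ (t : HexVertex) (ω₀ : (hexDomainGraph D.carrier δ).Walk (root δ) t), ω₀.IsPath →
            (∀ v ∈ ω₀.support,
              dist ((δ : ℂ) * hexCenter v) ((δ : ℂ) * hexCenter (root δ)) ≤ ρin k) →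
            carvedLaw D.carrier δ {v | v ∈ ω₀.support ∧ v ≠ t} t (tgt δ)
                {η | ¬ BandSuccess D.carrier δ ρ (P k) S (root δ)
                  (ω₀.support ++ η.walk.support.tail)} ≤
              ENNReal.ofReal c₀) ∧
      hexSAWLaw D.carrier δ (root δ) (tgt δ)
          {γ | ∃ (l₁ l₂ : List HexVertex) (u v : HexVertex), γ.walk.support = l₁ ++ u :: l₂ ∧ v ∈ l₂ ∧
            P k / 2 ≤ dist ((δ : ℂ) * hexCenter u) zr ∧
              dist ((δ : ℂ) * hexCenter v) zr ≤ rNB (P k / 2)} ≤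
        ENNReal.ofReal (ε / (4 * ((n + 1 : ℕ) : ℝ))) ∧
      dist ((δ : ℂ) * hexCenter (root δ)) zr < P k / 4 ∧
      dist ((δ : ℂ) * hexCenter (root δ)) zr < rNB (P k / 2) / 2 ∧ δ < ρin k / 2 := by
    refine (Filter.eventually_all_finset _).2 fun k hk => ?_
    rw [Finset.mem_range] at hk
    obtain ⟨hPk, -, hρk, -, -, -⟩ := hsc k hk
    refine (hNf k hk).and ((hrNB (P k / 2) (by positivity)).and
      ((Metric.tendsto_nhds.1 hroot _ (by positivity)).and
        ((Metric.tendsto_nhds.1 hroot _ (half_pos (hrNB0 _))).and ?_)))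
    exact mem_nhdsWithin_of_mem_nhds (Iio_mem_nhds (by positivity))
  have hδ0 : ∀ᶠ δ : ℝ in 𝓝[>] 0, 0 < δ := eventually_mem_nhdsWithin
  have htgt' : ∀ᶠ δ : ℝ in 𝓝[>] 0, dist ((δ : ℂ) * hexCenter (tgt δ)) zt < R / 4 :=
    Metric.tendsto_nhds.1 htgt _ (by positivity)
  have hroot' : ∀ᶠ δ : ℝ in 𝓝[>] 0, dist ((δ : ℂ) * hexCenter (root δ)) zr < R / 4 :=
    Metric.tendsto_nhds.1 hroot _ (by positivity)
  filter_upwards [hall, hδ0, htgt', hroot'] with δ hk hδ hδt hδr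
  -- AT A FIXED MESH: the bands, the positions, the assembly
  have hBex : ∀ k, ∃ S : ℕ → Set HexVertex, k < n + 1 →
      BandFamily D.carrier δ (ρin k) (θ * ρin k) ρ (2 * R) z₀ w (Nf k) j (root δ) S ∧
        ∀ (t : HexVertex) (ω₀ : (hexDomainGraph D.carrier δ).Walk (root δ) t), ω₀.IsPath →
          (∀ v ∈ ω₀.support,
            dist ((δ : ℂ) * hexCenter v) ((δ : ℂ) * hexCenter (root δ)) ≤ ρin k) →
          carvedLaw D.carrier δ {v | v ∈ ω₀.support ∧ v ≠ t} t (tgt δ)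
              {η | ¬ BandSuccess D.carrier δ ρ (P k) S (root δ)
                (ω₀.support ++ η.walk.support.tail)} ≤
            ENNReal.ofReal c₀ := by
    intro k
    by_cases hk' : k < n + 1
    · obtain ⟨S, hS⟩ := (hk k (Finset.mem_range.2 hk')).1
      exact ⟨S, fun _ => hS⟩
    · exact ⟨fun _ => ∅, fun h => absurd h hk'⟩
  choose B hB using hBex
  have hz₀' : 2 * R ≤ dist z₀ ((δ : ℂ) * hexCenter (root δ)) := by
    have := dist_triangle z₀ ((δ : ℂ) * hexCenter (root δ)) zr
    linarith
  have htgt'' : R ≤ dist ((δ : ℂ) * hexCenter (tgt δ)) ((δ : ℂ) * hexCenter (root δ)) := by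
    have := dist_triangle4 zr ((δ : ℂ) * hexCenter (root δ)) ((δ : ℂ) * hexCenter (tgt δ)) zt
    linarith [dist_comm zr ((δ : ℂ) * hexCenter (root δ)),
      dist_comm ((δ : ℂ) * hexCenter (root δ)) ((δ : ℂ) * hexCenter (tgt δ))]
  obtain ⟨S, h1, h2, h3, h4, h5, h6, h7, h8⟩ := stub_bandAssembly D.carrier δ ρ R θ (max c₀ 0)
    (ε / (4 * ((n + 1 : ℕ) : ℝ))) zr z₀ w (∑ k ∈ Finset.range (n + 1), Nf k) (n + 1) j (root δ)
    (tgt δ) P ρin (fun k => rNB (P k / 2)) B hm hc₁0 hε'.le hδ hθ.le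
    (fun k hk' => ⟨(hsc k hk').1, (hsc k hk').2.1, (hsc k hk').2.2.1, (hsc k hk').2.2.2.2.1,
      (hsc k hk').2.2.2.2.2⟩)
    hdec hsep (fun k hk' => (hk k (Finset.mem_range.2 hk')).2.2.2.2.le)
    (fun k hk' => (hk k (Finset.mem_range.2 hk')).2.2.1.le)
    (fun k hk' => (hk k (Finset.mem_range.2 hk')).2.2.2.1.le) hz₀' htgt''
    (fun k hk' => ⟨bandFamily_mono (hB k hk').1
        (Finset.single_le_sum (fun i _ => Nat.zero_le (Nf i)) (Finset.mem_range.2 hk')),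
      fun t ω₀ hπ hS => ((hB k hk').2 t ω₀ hπ hS).trans (ENNReal.ofReal_le_ofReal (le_max_left _ _))⟩)
    (fun k hk' => (hk k (Finset.mem_range.2 hk')).2.1)
  refine ⟨S, h1, h2, h3, h4, h5, h6, h7, h8.trans (ENNReal.ofReal_le_ofReal ?_)⟩
  -- `m ε' + (max c₀ 0) ^ m ≤ ε / 4 + ε / 4 ≤ ε`
  have hmε : ((n + 1 : ℕ) : ℝ) * (ε / (4 * ((n + 1 : ℕ) : ℝ))) = ε / 4 := by
    field_simp
  linarith

end Summit.CriticalPhenomena.SAWScalingLimit.Theorems.ObservableToSLE.TypeLadder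

end
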